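import Summits.RiemannHypothesis.RiemannHypothesis.Theses.ScrewLemmaKCoprofile
import HarnessLib

/-!
# Route `ScrewLemmaKCoprofile`, item `MomentGramFloor` (K3, stmt-RiemannHypothesis-21614)

The generic GRAM FLOOR (dual certificate, no `ζ`): every `Φ ∈ L²(0,1)` with
`∫₀¹ Φ(t)√t dt = ∫₀¹ Φ(t)·t dt = 0` satisfies `36 (∫₀¹ Φ)² ≤ ∫₀¹ Φ²`.

Proof: with the ray `r(t) = 1 − (10/3)√t + (5/2)t` (first row `(36, −120, 90)/36` of the inverse of
the Cauchy/Hilbert Gram matrix of `1, √t, t` on `(0,1)`) one has `∫ Φ r = ∫ Φ =: m` by the two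
moment hypotheses and `∫₀¹ r² = 1/36` (FTC on an explicit `rpow` antiderivative), so
`0 ≤ ∫ (Φ − 36 m r)² = ∫ Φ² − 72 m² + 36 m² = ∫ Φ² − 36 m²`.  The constant is sharp (equality at
`Φ = r`).  Adapted from the desk proofs attached to the item (rh-idea-5 `K3_MomentGramFloor.lean`,
refuter `K3.lean`).  RH-free real analysis; nothing here bears on the truth of RH.

Main result: `momentGramFloor_proof : …Theses.ScrewLemmaKCoprofile.MomentGramFloor` (the route decl
by name).
-/

set_option linter.dupNamespace false

noncomputable section

namespace Summit.RiemannHypothesis.RiemannHypothesis.Theorems.ScrewLemmaKCoprofile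

open MeasureTheory Set Real intervalIntegral

/-- The explicit antiderivative
`R(t) = t − (40/9)t^{3/2} + (145/18)t² − (20/3)t^{5/2} + (25/12)t³` of
`r(t)² = 1 − (20/3)t^{1/2} + (145/9)t − (50/3)t^{3/2} + (25/4)t²`. [folklore] -/
theorem hasDerivAt_gramRayPrim (t : ℝ) :
    HasDerivAt (fun x : ℝ =>
        x - 40 / 9 * x ^ (3 / 2 : ℝ) + 145 / 18 * x ^ 2 - 20 / 3 * x ^ (5 / 2 : ℝ) + 25 / 12 * x ^ 3)
      (1 - 20 / 3 * t ^ (1 / 2 : ℝ) + 145 / 9 * t - 50 / 3 * t ^ (3 / 2 : ℝ) + 25 / 4 * t ^ 2) t := by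
  have h32 : HasDerivAt (fun x : ℝ => x ^ (3 / 2 : ℝ)) ((3 / 2 : ℝ) * t ^ ((3 / 2 : ℝ) - 1)) t :=
    Real.hasDerivAt_rpow_const (Or.inr (by norm_num))
  have h52 : HasDerivAt (fun x : ℝ => x ^ (5 / 2 : ℝ)) ((5 / 2 : ℝ) * t ^ ((5 / 2 : ℝ) - 1)) t :=
    Real.hasDerivAt_rpow_const (Or.inr (by norm_num))
  have e1 : (3 / 2 : ℝ) - 1 = 1 / 2 := by norm_num
  have e2 : (5 / 2 : ℝ) - 1 = 3 / 2 := by norm_num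
  rw [e1] at h32
  rw [e2] at h52
  have hid : HasDerivAt (fun x : ℝ => x) 1 t := hasDerivAt_id t
  have h2 : HasDerivAt (fun x : ℝ => x ^ 2) (2 * t) t := by
    simpa using hasDerivAt_pow 2 t
  have h3 : HasDerivAt (fun x : ℝ => x ^ 3) (3 * t ^ 2) t := by
    simpa using hasDerivAt_pow 3 t
  have key := (((hid.sub (h32.const_mul (40 / 9))).add (h2.const_mul (145 / 18))).sub
    (h52.const_mul (20 / 3))).add (h3.const_mul (25 / 12))
  exact key.congr_deriv (by ring)

/-- `∫₀¹ r(t)² dt = 1/36` for the Gram ray `r(t) = 1 − (10/3)√t + (5/2)t`. [folklore] -/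
theorem integral_gramRay_sq :
    ∫ t in (0:ℝ)..1, (1 - 10 / 3 * Real.sqrt t + 5 / 2 * t) ^ 2 = 1 / 36 := by
  have hcongr : EqOn (fun t : ℝ => (1 - 10 / 3 * Real.sqrt t + 5 / 2 * t) ^ 2)
      (fun t => 1 - 20 / 3 * t ^ (1 / 2 : ℝ) + 145 / 9 * t - 50 / 3 * t ^ (3 / 2 : ℝ) + 25 / 4 * t ^ 2)
      (uIcc (0:ℝ) 1) := by
    intro t ht
    rw [uIcc_of_le zero_le_one] at ht
    have ht0 : 0 ≤ t := ht.1
    have hs : Real.sqrt t = t ^ (1 / 2 : ℝ) := Real.sqrt_eq_rpow t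
    have h32 : t ^ (3 / 2 : ℝ) = t * t ^ (1 / 2 : ℝ) := by
      rw [show (3 / 2 : ℝ) = 1 + 1 / 2 by norm_num, Real.rpow_add' ht0 (by norm_num), Real.rpow_one]
    have hsq : t ^ (1 / 2 : ℝ) * t ^ (1 / 2 : ℝ) = t := by
      rw [← Real.rpow_add' ht0 (by norm_num)]; norm_num
    simp only
    rw [hs, h32]
    linear_combination (100 / 9 : ℝ) * hsq
  rw [intervalIntegral.integral_congr hcongr]
  have hint : IntervalIntegrable
      (fun t : ℝ => 1 - 20 / 3 * t ^ (1 / 2 : ℝ) + 145 / 9 * t - 50 / 3 * t ^ (3 / 2 : ℝ) + 25 / 4 * t ^ 2)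
      volume 0 1 := by
    apply ContinuousOn.intervalIntegrable
    rw [uIcc_of_le zero_le_one]
    intro t ht
    apply ContinuousAt.continuousWithinAt
    have c1 : ContinuousAt (fun x : ℝ => x ^ (1 / 2 : ℝ)) t :=
      Real.continuousAt_rpow_const t (1 / 2) (Or.inr (by norm_num))
    have c2 : ContinuousAt (fun x : ℝ => x ^ (3 / 2 : ℝ)) t :=
      Real.continuousAt_rpow_const t (3 / 2) (Or.inr (by norm_num))
    fun_prop
  rw [intervalIntegral.integral_eq_sub_of_hasDerivAt (fun t _ => hasDerivAt_gramRayPrim t) hint]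
  norm_num [Real.zero_rpow, Real.one_rpow]

/-- **Item `MomentGramFloor` (K3, stmt-RiemannHypothesis-21614)**, the route decl by name: for
`Φ ∈ L²(0,1)` with `∫ Φ√t = ∫ Φ·t = 0`, `36 (∫₀¹ Φ)² ≤ ∫₀¹ Φ²` (Cauchy–Schwarz against the Gram ray
`r(t) = 1 − (10/3)√t + (5/2)t`, `‖r‖² = 1/36`). RH-free. [folklore] -/
theorem momentGramFloor_proof :
    Summit.RiemannHypothesis.RiemannHypothesis.Theses.ScrewLemmaKCoprofile.MomentGramFloor := by
  unfold Summit.RiemannHypothesis.RiemannHypothesis.Theses.ScrewLemmaKCoprofile.MomentGramFloor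
  intro Φ hΦ h1 h2
  set μ : Measure ℝ := volume.restrict (Set.Ioo (0:ℝ) 1) with hμ
  haveI : IsFiniteMeasure μ := by
    rw [hμ]; exact isFiniteMeasure_restrict.mpr (by simp)
  set m : ℝ := ∫ t, Φ t ∂μ with hm
  -- integrability bookkeeping
  have hΦi : Integrable Φ μ := hΦ.integrable one_le_two
  have hΦ2 : Integrable (fun t => Φ t ^ 2) μ := hΦ.integrable_sq
  have hae : ∀ᵐ t ∂μ, t ∈ Set.Ioo (0:ℝ) 1 := by
    rw [hμ]; exact ae_restrict_mem measurableSet_Ioo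
  have hr_cont : Continuous (fun t : ℝ => 1 - 10 / 3 * Real.sqrt t + 5 / 2 * t) := by
    have := Real.continuous_sqrt
    fun_prop
  have hrb : ∀ᵐ t ∂μ, ‖(1 - 10 / 3 * Real.sqrt t + 5 / 2 * t)‖ ≤ 7 := hae.mono fun t ht => by
    have h0 : 0 ≤ Real.sqrt t := Real.sqrt_nonneg t
    have h1' : Real.sqrt t ≤ 1 := by
      calc Real.sqrt t ≤ Real.sqrt 1 := Real.sqrt_le_sqrt ht.2.le
        _ = 1 := Real.sqrt_one
    rw [Real.norm_eq_abs, abs_le]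
    constructor <;> nlinarith [ht.1, ht.2]
  have hΦr : Integrable (fun t => (1 - 10 / 3 * Real.sqrt t + 5 / 2 * t) * Φ t) μ :=
    hΦi.bdd_mul hr_cont.aestronglyMeasurable hrb
  have hsb : ∀ᵐ t ∂μ, ‖Real.sqrt t‖ ≤ 1 := hae.mono fun t ht => by
    rw [Real.norm_eq_abs, abs_of_nonneg (Real.sqrt_nonneg t)]
    calc Real.sqrt t ≤ Real.sqrt 1 := Real.sqrt_le_sqrt ht.2.le
      _ = 1 := Real.sqrt_one
  have hΦs : Integrable (fun t => Real.sqrt t * Φ t) μ :=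
    hΦi.bdd_mul Real.continuous_sqrt.aestronglyMeasurable hsb
  have htb : ∀ᵐ t ∂μ, ‖t‖ ≤ 1 := hae.mono fun t ht => by
    rw [Real.norm_eq_abs, abs_of_nonneg ht.1.le]; exact ht.2.le
  have hΦt : Integrable (fun t => t * Φ t) μ :=
    hΦi.bdd_mul continuous_id.aestronglyMeasurable htb
  have hr2 : Integrable (fun t => (1 - 10 / 3 * Real.sqrt t + 5 / 2 * t) ^ 2) μ := by
    refine (integrable_const (49:ℝ)).mono' (hr_cont.pow 2).aestronglyMeasurable
      (hrb.mono fun t ht => ?_)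
    rw [Real.norm_eq_abs] at ht ⊢
    rw [abs_pow]
    nlinarith [abs_nonneg (1 - 10 / 3 * Real.sqrt t + 5 / 2 * t)]
  -- `∫ Φ r = m`
  have hIr : ∫ t, (1 - 10 / 3 * Real.sqrt t + 5 / 2 * t) * Φ t ∂μ = m := by
    have e : (fun t => (1 - 10 / 3 * Real.sqrt t + 5 / 2 * t) * Φ t)
        = fun t => Φ t - 10 / 3 * (Real.sqrt t * Φ t) + 5 / 2 * (t * Φ t) := by
      funext t; ring
    have h1' : ∫ t, Real.sqrt t * Φ t ∂μ = 0 := by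
      rw [← h1]; exact integral_congr_ae (Filter.Eventually.of_forall fun t => by simp only; ring)
    have h2' : ∫ t, t * Φ t ∂μ = 0 := by
      rw [← h2]; exact integral_congr_ae (Filter.Eventually.of_forall fun t => by simp only; ring)
    rw [e, MeasureTheory.integral_add, MeasureTheory.integral_sub, MeasureTheory.integral_const_mul,
      MeasureTheory.integral_const_mul, h1', h2', hm]
    · ring
    all_goals first
      | exact hΦi
      | exact (hΦs.const_mul _)
      | exact (hΦt.const_mul _)
      | exact (hΦi.sub (hΦs.const_mul _))
  -- `∫ r² = 1/36`
  have hIr2 : ∫ t, (1 - 10 / 3 * Real.sqrt t + 5 / 2 * t) ^ 2 ∂μ = 1 / 36 := by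
    rw [hμ, ← integral_Ioc_eq_integral_Ioo, ← intervalIntegral.integral_of_le zero_le_one]
    exact integral_gramRay_sq
  -- expand the square `0 ≤ ∫ (Φ − 36 m r)²`
  have hnn : 0 ≤ ∫ t, (Φ t - 36 * m * (1 - 10 / 3 * Real.sqrt t + 5 / 2 * t)) ^ 2 ∂μ :=
    integral_nonneg fun t => sq_nonneg _
  have hexp : ∫ t, (Φ t - 36 * m * (1 - 10 / 3 * Real.sqrt t + 5 / 2 * t)) ^ 2 ∂μ
      = (∫ t, Φ t ^ 2 ∂μ) - 2 * (36 * m) * m + (36 * m) ^ 2 * (1 / 36) := by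
    have e : (fun t => (Φ t - 36 * m * (1 - 10 / 3 * Real.sqrt t + 5 / 2 * t)) ^ 2)
        = fun t => Φ t ^ 2 - 2 * (36 * m) * ((1 - 10 / 3 * Real.sqrt t + 5 / 2 * t) * Φ t)
            + (36 * m) ^ 2 * (1 - 10 / 3 * Real.sqrt t + 5 / 2 * t) ^ 2 := by
      funext t; ring
    rw [e, MeasureTheory.integral_add, MeasureTheory.integral_sub, MeasureTheory.integral_const_mul,
      MeasureTheory.integral_const_mul, hIr, hIr2]
    all_goals first
      | exact hΦ2
      | exact (hΦr.const_mul _)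
      | exact (hr2.const_mul _)
      | exact (hΦ2.sub (hΦr.const_mul _))
  rw [hexp] at hnn
  nlinarith [hnn]

end Summit.RiemannHypothesis.RiemannHypothesis.Theorems.ScrewLemmaKCoprofile

end
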